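import Summits.BirchSwinnertonDyer.BirchSwinnertonDyer.Theorems.EisensteinPrimesBSDpOnCellCStubC3OneInequality
import Summits.BirchSwinnertonDyer.BirchSwinnertonDyer.Theorems.EisensteinPrimesBSDpOnCellCStubC3RoadHOther
import Summits.BirchSwinnertonDyer.BirchSwinnertonDyer.Theorems.EisensteinPrimesBSDpOnCellCReorientedComposition
import Summits.BirchSwinnertonDyer.BirchSwinnertonDyer.Theorems.EisensteinPrimesBSDpOnCellCOfLZZFact
import HarnessLib

/-!
# Crux 4 `BSDpOnCellC` (stmt-BirchSwinnertonDyer-19034), line b1 v10, stub `stub_c3`: BOTH DIVISIBILITY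
# ROADS TOGETHER NEED NO `λ`-COMPARISON — c3♭′ / c3s♭′, `stub_c3` VERBATIM and the crux BY NAME from
# [road R-β: `𝓕♭ ∣ p^k·𝓛`] + [road H: `𝓛 ∣ p^a·𝓕♭`] + [`μ = 0` on both sides] (+ published facts,
# + crux 3) (cell `bsd-eis`, seat `bsd-line-x2-p2` gen 2, D-0154 KEY row 5; route `EisensteinPrimes`;
# companions p611576 `…StubC3OneInequality`, p613384 `…ResidualPub`)

HONEST FRAMING (cell `bsd-eis`, run/shared/lean/pub/bsd-eis/): pure commutative algebra of `𝓞_{ℂ_p}⟦T⟧`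
plus composition; CONDITIONAL on hypothesis-shaped inputs stated INLINE or as REGISTERED named facts;
nothing about any curve is asserted; nothing booked; X2 stays CONSTRUCTION-SHAPED; no label or count
moves; BSD and the main conjectures are proved for NO curve by this file. Helper attached to
stmt-BirchSwinnertonDyer-19034 (`--supports`); it closes no stub.

## Why

p611576 / p613384 showed: one divisibility road + `μ = 0` both sides + ONE `λ`-inequality ⟹ the IMC atom.
The two roads are typed independently in the tree (`X2.Nonsplit/SplitKolyvaginDivOnTreeIntOther` = the
Euler-system upper bound up to `p^k`; `X2.HidaLimitRevDivOnTreeIntOther` = the Hida-limit /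
Eisenstein-congruence lower bound up to `p^a`). If BOTH are supplied, each carries its free Weierstrass-
degree inequality (p611576 `le_of_C_pow_mul_mem`), so the two inequalities meet and NO `λ`-comparison
(Keller–Yin `algmain`, the Greenberg–Vatsal count) is needed at all — only `μ = 0` on both sides (to read
Weierstrass degrees). This is the classical «two divisibilities up to powers of `p` + `μ = 0` ⟹ equality»
closing of a main conjecture, in the wide receptacle:

* §1 `span_singleton_eq_of_C_pow_mul_mem_of_C_pow_mul_mem` — in `𝓞_{ℂ_p}⟦T⟧`: `p^k L ∈ (F)`, `p^a F ∈ (L)`,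
  `F` with first unit coefficient at `n`, `L` at `m` ⟹ `(F) = (L)` (and `n = m`).
* §2 `nonsplit/splitIMCEqOnTreeIntOther_of_div_of_revDiv_of_mu` — c3♭′ / c3s♭′ from R-β + H + PUB ×4
  (torsion, c3h g4) + per-datum [`μ(X_ac^∅ strict at 𝔭̄) = 0` ∧ the frame has SOME first unit coefficient].
* §3 `stub_c3_of_pub_of_div_of_revDiv_of_mu` — the registered `stub_c3` signature VERBATIM from these;
  `bsdpOnCellC_of_publishedFacts_of_div_of_revDiv_of_mu_of_cellB` — the crux BY NAME from
  `stub_publishedFacts`' 17-conjunct signature VERBATIM + R-β (both signs) + H + the `μ`-data + crux 3.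

So, by name: crux 4 on line b1 at the published tier = 17 refereed facts + crux 3 + EITHER {R-β, `μ`'s,
`λ(𝓛) ≤ λ(X_ac^∅)`} (p613384) OR {R-β, H, `μ`'s} (this file) — the `λ`-lower-bound and road H are
interchangeable currencies for the same wall. What this is NOT: not a proof of any input.

References: [Washington1997] §7.1 Prop. 7.2 / Thm. 7.3, §13.2; [KellerYin2024] §3, §5.1 (a)–(e), Thm. 5.1.3
(arXiv:2402.12781v2, PRE — locator only); [SkinnerUrban2014] §3.1.6 (the two-divisibility closing, context);
cell: RULING L31, p489067, p611576, p613384.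
-/

set_option autoImplicit false
set_option linter.dupNamespace false -- the summit namespace `…BirchSwinnertonDyer.BirchSwinnertonDyer.Theorems` (Sub = Summit, D-0017) trips it

noncomputable section

open scoped Classical MatrixGroups ModularForm

open CongruenceSubgroup WeierstrassCurve NumberField IsDedekindDomain Field PowerSeries
  Literature.NumberTheory.EllipticCurves Literature.NumberTheory.EllipticCurves.GreenbergSelmer
  Literature.NumberTheory.EllipticCurves.GreenbergVatsal2000
  Literature.NumberTheory.EllipticCurves.ModularForms Literature.NumberTheory.QuadraticFields
  Literature.NumberTheory.EllipticCurves.Rank1Residual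
  Literature.NumberTheory.EllipticCurves.Rank1Residual.Typed
  Literature.NumberTheory.EllipticCurves.KrizLi2019
  Literature.NumberTheory.EllipticCurves.Wuthrich2014
  Literature.NumberTheory.EllipticCurves.SteinWuthrich2013
  Literature.NumberTheory.EllipticCurves.Castella2018Exceptional
  Literature.NumberTheory.GaloisRepresentations Literature.NumberTheory.GaloisCohomology
  Literature.NumberTheory.Automorphic
  Summit.BirchSwinnertonDyer.Rank1Residual.X11b.AcSelmer
  Summit.BirchSwinnertonDyer.Rank1Residual.X11b.Halves
  Summit.BirchSwinnertonDyer.Rank1Residual.X11b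
  Summit.BirchSwinnertonDyer.Rank1Residual Summit.BirchSwinnertonDyer.Rank1Residual.X1
  Summit.BirchSwinnertonDyer.Rank1Residual.X2
  Summit.BirchSwinnertonDyer.BirchSwinnertonDyer.Theorems.StubC3MuLambdaInvariants
  Summit.BirchSwinnertonDyer.BirchSwinnertonDyer.Theorems.StubC3OneInequality

namespace Summit.BirchSwinnertonDyer.BirchSwinnertonDyer.Theorems.StubC3TwoDivisibilities

variable {p : ℕ} [Fact p.Prime]

/-! ### §1 Two divisibilities up to powers of `p` + shapes ⟹ equality of ideals -/

/-- **Mutual divisibility after inverting `p`, plus `μ = 0` on both sides, gives equal ideals.** In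
`𝓞_{ℂ_p}⟦T⟧`: if `p^k · L ∈ (F)` and `p^a · F ∈ (L)`, `F` has its first unit coefficient at `n` and `L` at
`m`, then `n = m` and `(F) = (L)` (each divisibility gives one inequality, p611576). [cite: Washington1997, §7.1 (Prop. 7.2, Thm. 7.3)] -/
theorem span_singleton_eq_of_C_pow_mul_mem_of_C_pow_mul_mem {F L : PowerSeries 𝓞_ℂ_[p]} {k a n m : ℕ}
    (hdiv : C ((p : 𝓞_ℂ_[p]) ^ k) * L ∈ Ideal.span ({F} : Set (PowerSeries 𝓞_ℂ_[p])))
    (hrev : C ((p : 𝓞_ℂ_[p]) ^ a) * F ∈ Ideal.span ({L} : Set (PowerSeries 𝓞_ℂ_[p])))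
    (hF : ‖((coeff n F : 𝓞_ℂ_[p]) : ℂ_[p])‖ = 1 ∧ ∀ i < n, ‖((coeff i F : 𝓞_ℂ_[p]) : ℂ_[p])‖ < 1)
    (hL : ‖((coeff m L : 𝓞_ℂ_[p]) : ℂ_[p])‖ = 1 ∧ ∀ i < m, ‖((coeff i L : 𝓞_ℂ_[p]) : ℂ_[p])‖ < 1) :
    Ideal.span ({F} : Set (PowerSeries 𝓞_ℂ_[p])) = Ideal.span {L} :=
  span_singleton_eq_of_C_pow_mul_mem_of_le hdiv hF hL (le_of_C_pow_mul_mem hrev hL hF)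

/-- The two indices agree under mutual divisibility. [cite: Washington1997, §7.1 (Prop. 7.2, Thm. 7.3)] -/
theorem firstUnitCoeff_index_eq_of_C_pow_mul_mem_of_C_pow_mul_mem {F L : PowerSeries 𝓞_ℂ_[p]}
    {k a n m : ℕ}
    (hdiv : C ((p : 𝓞_ℂ_[p]) ^ k) * L ∈ Ideal.span ({F} : Set (PowerSeries 𝓞_ℂ_[p])))
    (hrev : C ((p : 𝓞_ℂ_[p]) ^ a) * F ∈ Ideal.span ({L} : Set (PowerSeries 𝓞_ℂ_[p])))
    (hF : ‖((coeff n F : 𝓞_ℂ_[p]) : ℂ_[p])‖ = 1 ∧ ∀ i < n, ‖((coeff i F : 𝓞_ℂ_[p]) : ℂ_[p])‖ < 1)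
    (hL : ‖((coeff m L : 𝓞_ℂ_[p]) : ℂ_[p])‖ = 1 ∧ ∀ i < m, ‖((coeff i L : 𝓞_ℂ_[p]) : ℂ_[p])‖ < 1) :
    n = m :=
  le_antisymm (le_of_C_pow_mul_mem hdiv hF hL) (le_of_C_pow_mul_mem hrev hL hF)

/-! ### §2 c3♭′ / c3s♭′ from both roads + `μ = 0` on both sides -/

section Datum

variable {W : WeierstrassCurve ℚ} [W.IsElliptic] [W.IsGloballyMinimal]

/-- **c3♭′ from BOTH divisibility roads and `μ = 0` on both sides — NO `λ`-comparison.** Given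
GZK, modularity, Poitou–Tate ×2 (torsion), road R-β `X2.NonsplitKolyvaginDivOnTreeIntOther W p` (`𝓕♭ ∣ p^k Q`) AND road H
`X2.HidaLimitRevDivOnTreeIntOther W p` (`Q ∣ p^a 𝓕♭`): at every datum with `μ(X_ac^∅ strict at 𝔭̄) = 0`
and SOME first unit coefficient of the frame `Q` (`μ(𝓛) = 0`), the atom `X2.NonsplitIMCEqOnTreeIntOther W p` holds.
CONDITIONAL; nothing booked. [claim: KellerYin2024, status: under-review]
[cite: KellerYin2024, §3, §5.1 (a)–(e) and Thm. 5.1.3 = Thm. D (arXiv:2402.12781v2) (shape only; nothing asserted)]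
[cite: Washington1997, §13.2 and §7.1 Prop. 7.2] -/
theorem nonsplitIMCEqOnTreeIntOther_of_div_of_revDiv_of_mu
    (hGZK : rank_eq_analyticRank_of_analyticRank_le_one) (hnf : exists_isNewformOf)
    (hPT : ∀ (K : Type) [Field K] [NumberField K], poitouTate_selmerStructure_duality K)
    (hPT2 : ∀ (K : Type) [Field K] [NumberField K], poitouTate_sha_tateDual K)
    (hdiv : NonsplitKolyvaginDivOnTreeIntOther W p) (hrev : HidaLimitRevDivOnTreeIntOther W p)
    (h : ∀ (N : ℕ) [NeZero N] (K : Type) [Field K] [NumberField K] (Dt : ModularParametrizationData W N)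
        (H : HeegnerDatum N (NumberField.discr K)) (ιK : K →+* ℂ) (P : (W.baseChange K).toAffine.Point),
        CellC W p → ¬ W.HasSplitMultiplicativeReductionAtPrime p → W.conductorNorm ℤ = N →
        IsImaginaryQuadratic K → NumberField.discr K < -4 → SatisfiesHeegnerHypothesis N K →
        (W.quadraticTwist (NumberField.discr K : ℚ)).entireLFunction 1 ≠ 0 →
        WeierstrassCurve.Affine.Point.map ιK.toRatAlgHom P = heegnerPointComplex Dt H →
        ¬ (p : ℤ) ∣ Dt.c → ¬ IsOfFinAddOrder P →
        Odd (NumberField.discr K) →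
        ∀ (κ : ZpExtension K p), κ.IsAnticyclotomic →
          ∀ (γ : Field.absoluteGaloisGroup K) [Fact (κ.IsTopGenerator γ)]
            (𝔭 : HeightOneSpectrum (𝓞 K)), ((p : ℕ) : 𝓞 K) ∈ 𝔭.asIdeal →
            𝔭.asIdeal.ramificationIdx (𝓞 ℚ) = 1 → 𝔭.asIdeal.inertiaDeg (𝓞 ℚ) = 1 →
            ∀ (𝔭bar : HeightOneSpectrum (𝓞 K)), ((p : ℕ) : 𝓞 K) ∈ 𝔭bar.asIdeal → 𝔭bar ≠ 𝔭 →
              ((Ideal.span {(p : ℤ)}).primesOver (𝓞 K)).ncard = 2 →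
            ∀ (f : CuspForm (CongruenceSubgroup.Gamma0 N) 2), IsNewformOf W f →
              ∀ (ι' : PadicAlgCl p ≃+* ℂ),
                (∀ (w : InfinitePlace K) (k : 𝓞 K),
                  k ∈ 𝔭.asIdeal ↔ ‖ι'.symm (w.embedding (k : K))‖ < 1) →
                ∀ (ΩK : ℂ) (Ωp : ℂ_[p]) (Q : PowerSeries 𝓞_ℂ_[p]), ΩK ≠ 0 → ‖Ωp‖ = 1 →
                  R1.IsBDPLFunctionInt p ι' 𝔭 κ γ f ΩK Ωp Q →
                    muInvariant p (XAc (W.baseChange K) p κ 𝔭bar ∅ γ) = 0 ∧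
                    ∃ m : ℕ, ‖((PowerSeries.coeff m Q : 𝓞_ℂ_[p]) : ℂ_[p])‖ = 1 ∧
                      ∀ i < m, ‖((PowerSeries.coeff i Q : 𝓞_ℂ_[p]) : ℂ_[p])‖ < 1) :
    NonsplitIMCEqOnTreeIntOther W p := by
  intro N _ K _ _ Dt H ιK P hc hsg hN hK hd4 hHN hLt hP hcM hPinf hodd κ hκ γ _ 𝔭 h𝔭 he hf 𝔭bar h𝔭bar
    hne hsplit f hfW ι' hι' ΩK Ωp Q hΩK hΩp hQ
  obtain ⟨F, hF⟩ :=
    (charIdeal_isPrincipal_holds p (XAc (W.baseChange K) p κ 𝔭bar ∅ γ)).principal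
  have hchar : XAc.charIdeal (W.baseChange K) p κ 𝔭bar ∅ γ = Ideal.span {F} := hF
  obtain ⟨k, hk⟩ := hdiv N K Dt H ιK P hc hsg hN hK hd4 hHN hLt hP hcM hPinf hodd κ hκ γ 𝔭 h𝔭 he
    hf 𝔭bar h𝔭bar hne hsplit f hfW ι' hι' ΩK Ωp Q hΩK hΩp hQ
  obtain ⟨a, ha⟩ := hrev N K Dt H ιK P hc hN hK hd4 hHN hLt hP hcM hPinf hodd κ hκ γ 𝔭 h𝔭 he hf 𝔭bar
    h𝔭bar hne hsplit f hfW ι' hι' ΩK Ωp Q hΩK hΩp hQ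
    F hchar
  obtain ⟨hμ, m, hQm⟩ := h N K Dt H ιK P hc hsg hN hK hd4 hHN hLt hP hcM hPinf hodd κ hκ γ 𝔭 h𝔭 he
    hf 𝔭bar h𝔭bar hne hsplit f hfW ι' hι' ΩK Ωp Q hΩK hΩp hQ
  haveI := module_finite_XAc_baseChange (W := W) p κ 𝔭bar γ
  have htor := isTorsion_xAc_other_of_cellC hGZK hnf hPT hPT2 hc hK
    (fun q hq hqp ↦ hHN q hq (hqp.trans (hN ▸
      Summit.BirchSwinnertonDyer.Rank1Residual.X11b.dvd_conductorNorm_of_mult (W := W) hc.2.2.2)))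
    hLt P hPinf κ hκ γ 𝔭bar h𝔭bar
  have hFn := firstUnitCoeff_map_toCpInt_of_charIdeal_eq_span _ htor hμ hchar
  unfold R1.IMCEqIntAt
  rw [hchar, Ideal.map_span, Set.image_singleton] at hk ⊢
  exact span_singleton_eq_of_C_pow_mul_mem_of_C_pow_mul_mem hk ha hFn hQm

/-- **c3s♭′ from BOTH divisibility roads and `μ = 0` on both sides — NO `λ`-comparison.** Given
GZK, modularity, Poitou–Tate ×2 (torsion), road R-β `X2.SplitKolyvaginDivOnTreeIntOther W p` (`𝓕♭ ∣ p^k Q`) AND road H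
`X2.HidaLimitRevDivOnTreeIntOther W p` (`Q ∣ p^a 𝓕♭`): at every datum with `μ(X_ac^∅ strict at 𝔭̄) = 0`
and SOME first unit coefficient of the frame `Q` (`μ(𝓛) = 0`), the atom `X2.SplitIMCEqOnTreeIntOther W p` holds.
CONDITIONAL; nothing booked. [claim: KellerYin2024, status: under-review]
[cite: KellerYin2024, §3, §5.1 (a)–(e) and Thm. 5.1.3 = Thm. D (arXiv:2402.12781v2) (shape only; nothing asserted)]
[cite: Washington1997, §13.2 and §7.1 Prop. 7.2] -/
theorem splitIMCEqOnTreeIntOther_of_div_of_revDiv_of_mu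
    (hGZK : rank_eq_analyticRank_of_analyticRank_le_one) (hnf : exists_isNewformOf)
    (hPT : ∀ (K : Type) [Field K] [NumberField K], poitouTate_selmerStructure_duality K)
    (hPT2 : ∀ (K : Type) [Field K] [NumberField K], poitouTate_sha_tateDual K)
    (hdiv : SplitKolyvaginDivOnTreeIntOther W p) (hrev : HidaLimitRevDivOnTreeIntOther W p)
    (h : ∀ (N : ℕ) [NeZero N] (K : Type) [Field K] [NumberField K] (Dt : ModularParametrizationData W N)
        (H : HeegnerDatum N (NumberField.discr K)) (ιK : K →+* ℂ) (P : (W.baseChange K).toAffine.Point),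
        CellC W p → W.HasSplitMultiplicativeReductionAtPrime p → W.conductorNorm ℤ = N →
        IsImaginaryQuadratic K → NumberField.discr K < -4 → SatisfiesHeegnerHypothesis N K →
        (W.quadraticTwist (NumberField.discr K : ℚ)).entireLFunction 1 ≠ 0 →
        WeierstrassCurve.Affine.Point.map ιK.toRatAlgHom P = heegnerPointComplex Dt H →
        ¬ (p : ℤ) ∣ Dt.c → ¬ IsOfFinAddOrder P →
        Odd (NumberField.discr K) →
        ∀ (κ : ZpExtension K p), κ.IsAnticyclotomic →
          ∀ (γ : Field.absoluteGaloisGroup K) [Fact (κ.IsTopGenerator γ)]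
            (𝔭 : HeightOneSpectrum (𝓞 K)), ((p : ℕ) : 𝓞 K) ∈ 𝔭.asIdeal →
            𝔭.asIdeal.ramificationIdx (𝓞 ℚ) = 1 → 𝔭.asIdeal.inertiaDeg (𝓞 ℚ) = 1 →
            ∀ (𝔭bar : HeightOneSpectrum (𝓞 K)), ((p : ℕ) : 𝓞 K) ∈ 𝔭bar.asIdeal → 𝔭bar ≠ 𝔭 →
              ((Ideal.span {(p : ℤ)}).primesOver (𝓞 K)).ncard = 2 →
            ∀ (f : CuspForm (CongruenceSubgroup.Gamma0 N) 2), IsNewformOf W f →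
              ∀ (ι' : PadicAlgCl p ≃+* ℂ),
                (∀ (w : InfinitePlace K) (k : 𝓞 K),
                  k ∈ 𝔭.asIdeal ↔ ‖ι'.symm (w.embedding (k : K))‖ < 1) →
                ∀ (ΩK : ℂ) (Ωp : ℂ_[p]) (Q : PowerSeries 𝓞_ℂ_[p]), ΩK ≠ 0 → ‖Ωp‖ = 1 →
                  R1.IsBDPLFunctionInt p ι' 𝔭 κ γ f ΩK Ωp Q →
                    muInvariant p (XAc (W.baseChange K) p κ 𝔭bar ∅ γ) = 0 ∧
                    ∃ m : ℕ, ‖((PowerSeries.coeff m Q : 𝓞_ℂ_[p]) : ℂ_[p])‖ = 1 ∧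
                      ∀ i < m, ‖((PowerSeries.coeff i Q : 𝓞_ℂ_[p]) : ℂ_[p])‖ < 1) :
    SplitIMCEqOnTreeIntOther W p := by
  intro N _ K _ _ Dt H ιK P hc hsg hN hK hd4 hHN hLt hP hcM hPinf hodd κ hκ γ _ 𝔭 h𝔭 he hf 𝔭bar h𝔭bar
    hne hsplit f hfW ι' hι' ΩK Ωp Q hΩK hΩp hQ
  obtain ⟨F, hF⟩ :=
    (charIdeal_isPrincipal_holds p (XAc (W.baseChange K) p κ 𝔭bar ∅ γ)).principal
  have hchar : XAc.charIdeal (W.baseChange K) p κ 𝔭bar ∅ γ = Ideal.span {F} := hF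
  obtain ⟨k, hk⟩ := hdiv N K Dt H ιK P hc hsg hN hK hd4 hHN hLt hP hcM hPinf hodd κ hκ γ 𝔭 h𝔭 he
    hf 𝔭bar h𝔭bar hne hsplit f hfW ι' hι' ΩK Ωp Q hΩK hΩp hQ
  obtain ⟨a, ha⟩ := hrev N K Dt H ιK P hc hN hK hd4 hHN hLt hP hcM hPinf hodd κ hκ γ 𝔭 h𝔭 he hf 𝔭bar
    h𝔭bar hne hsplit f hfW ι' hι' ΩK Ωp Q hΩK hΩp hQ
    F hchar
  obtain ⟨hμ, m, hQm⟩ := h N K Dt H ιK P hc hsg hN hK hd4 hHN hLt hP hcM hPinf hodd κ hκ γ 𝔭 h𝔭 he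
    hf 𝔭bar h𝔭bar hne hsplit f hfW ι' hι' ΩK Ωp Q hΩK hΩp hQ
  haveI := module_finite_XAc_baseChange (W := W) p κ 𝔭bar γ
  have htor := isTorsion_xAc_other_of_cellC hGZK hnf hPT hPT2 hc hK
    (fun q hq hqp ↦ hHN q hq (hqp.trans (hN ▸
      Summit.BirchSwinnertonDyer.Rank1Residual.X11b.dvd_conductorNorm_of_mult (W := W) hc.2.2.2)))
    hLt P hPinf κ hκ γ 𝔭bar h𝔭bar
  have hFn := firstUnitCoeff_map_toCpInt_of_charIdeal_eq_span _ htor hμ hchar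
  unfold R1.IMCEqIntAt
  rw [hchar, Ideal.map_span, Set.image_singleton] at hk ⊢
  exact span_singleton_eq_of_C_pow_mul_mem_of_C_pow_mul_mem hk ha hFn hQm

end Datum

/-! ### §3 `stub_c3` VERBATIM and the crux BY NAME from both roads + `μ = 0` -/

/-- **`stub_c3` (line b1 v10) VERBATIM from PUB ×4 + road R-β (each sign) + road H + `μ = 0` on both
sides per datum** — no `λ`-comparison. CONDITIONAL; nothing booked. [claim: KellerYin2024, status: under-review]
[cite: KellerYin2024, §3, §5.1 (a)–(e) and Thm. 5.1.3 = Thm. D (arXiv:2402.12781v2) (shape only; nothing asserted)] -/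
theorem stub_c3_of_pub_of_div_of_revDiv_of_mu
    (hGZK : rank_eq_analyticRank_of_analyticRank_le_one) (hnf : exists_isNewformOf)
    (hPT : ∀ (K : Type) [Field K] [NumberField K], poitouTate_selmerStructure_duality K)
    (hPT2 : ∀ (K : Type) [Field K] [NumberField K], poitouTate_sha_tateDual K)
    (hdivN : ∀ (W : WeierstrassCurve ℚ) [W.IsElliptic] [W.IsGloballyMinimal] (p : ℕ) [Fact p.Prime],
      CellC W p → ¬ W.HasSplitMultiplicativeReductionAtPrime p → NonsplitKolyvaginDivOnTreeIntOther W p)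
    (hdivS : ∀ (W : WeierstrassCurve ℚ) [W.IsElliptic] [W.IsGloballyMinimal] (p : ℕ) [Fact p.Prime],
      CellC W p → W.HasSplitMultiplicativeReductionAtPrime p → SplitKolyvaginDivOnTreeIntOther W p)
    (hrev : ∀ (W : WeierstrassCurve ℚ) [W.IsElliptic] [W.IsGloballyMinimal] (p : ℕ) [Fact p.Prime],
      CellC W p → HidaLimitRevDivOnTreeIntOther W p)
    (hmuN : ∀ (W : WeierstrassCurve ℚ) [W.IsElliptic] [W.IsGloballyMinimal] (p : ℕ) [Fact p.Prime],
      ∀ (N : ℕ) [NeZero N] (K : Type) [Field K] [NumberField K] (Dt : ModularParametrizationData W N)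
        (H : HeegnerDatum N (NumberField.discr K)) (ιK : K →+* ℂ) (P : (W.baseChange K).toAffine.Point),
        CellC W p → ¬ W.HasSplitMultiplicativeReductionAtPrime p → W.conductorNorm ℤ = N →
        IsImaginaryQuadratic K → NumberField.discr K < -4 → SatisfiesHeegnerHypothesis N K →
        (W.quadraticTwist (NumberField.discr K : ℚ)).entireLFunction 1 ≠ 0 →
        WeierstrassCurve.Affine.Point.map ιK.toRatAlgHom P = heegnerPointComplex Dt H →
        ¬ (p : ℤ) ∣ Dt.c → ¬ IsOfFinAddOrder P →
        Odd (NumberField.discr K) →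
        ∀ (κ : ZpExtension K p), κ.IsAnticyclotomic →
          ∀ (γ : Field.absoluteGaloisGroup K) [Fact (κ.IsTopGenerator γ)]
            (𝔭 : HeightOneSpectrum (𝓞 K)), ((p : ℕ) : 𝓞 K) ∈ 𝔭.asIdeal →
            𝔭.asIdeal.ramificationIdx (𝓞 ℚ) = 1 → 𝔭.asIdeal.inertiaDeg (𝓞 ℚ) = 1 →
            ∀ (𝔭bar : HeightOneSpectrum (𝓞 K)), ((p : ℕ) : 𝓞 K) ∈ 𝔭bar.asIdeal → 𝔭bar ≠ 𝔭 →
              ((Ideal.span {(p : ℤ)}).primesOver (𝓞 K)).ncard = 2 →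
            ∀ (f : CuspForm (CongruenceSubgroup.Gamma0 N) 2), IsNewformOf W f →
              ∀ (ι' : PadicAlgCl p ≃+* ℂ),
                (∀ (w : InfinitePlace K) (k : 𝓞 K),
                  k ∈ 𝔭.asIdeal ↔ ‖ι'.symm (w.embedding (k : K))‖ < 1) →
                ∀ (ΩK : ℂ) (Ωp : ℂ_[p]) (Q : PowerSeries 𝓞_ℂ_[p]), ΩK ≠ 0 → ‖Ωp‖ = 1 →
                  R1.IsBDPLFunctionInt p ι' 𝔭 κ γ f ΩK Ωp Q →
                    muInvariant p (XAc (W.baseChange K) p κ 𝔭bar ∅ γ) = 0 ∧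
                    ∃ m : ℕ, ‖((PowerSeries.coeff m Q : 𝓞_ℂ_[p]) : ℂ_[p])‖ = 1 ∧
                      ∀ i < m, ‖((PowerSeries.coeff i Q : 𝓞_ℂ_[p]) : ℂ_[p])‖ < 1)
    (hmuS : ∀ (W : WeierstrassCurve ℚ) [W.IsElliptic] [W.IsGloballyMinimal] (p : ℕ) [Fact p.Prime],
      ∀ (N : ℕ) [NeZero N] (K : Type) [Field K] [NumberField K] (Dt : ModularParametrizationData W N)
        (H : HeegnerDatum N (NumberField.discr K)) (ιK : K →+* ℂ) (P : (W.baseChange K).toAffine.Point),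
        CellC W p → W.HasSplitMultiplicativeReductionAtPrime p → W.conductorNorm ℤ = N →
        IsImaginaryQuadratic K → NumberField.discr K < -4 → SatisfiesHeegnerHypothesis N K →
        (W.quadraticTwist (NumberField.discr K : ℚ)).entireLFunction 1 ≠ 0 →
        WeierstrassCurve.Affine.Point.map ιK.toRatAlgHom P = heegnerPointComplex Dt H →
        ¬ (p : ℤ) ∣ Dt.c → ¬ IsOfFinAddOrder P →
        Odd (NumberField.discr K) →
        ∀ (κ : ZpExtension K p), κ.IsAnticyclotomic →
          ∀ (γ : Field.absoluteGaloisGroup K) [Fact (κ.IsTopGenerator γ)]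
            (𝔭 : HeightOneSpectrum (𝓞 K)), ((p : ℕ) : 𝓞 K) ∈ 𝔭.asIdeal →
            𝔭.asIdeal.ramificationIdx (𝓞 ℚ) = 1 → 𝔭.asIdeal.inertiaDeg (𝓞 ℚ) = 1 →
            ∀ (𝔭bar : HeightOneSpectrum (𝓞 K)), ((p : ℕ) : 𝓞 K) ∈ 𝔭bar.asIdeal → 𝔭bar ≠ 𝔭 →
              ((Ideal.span {(p : ℤ)}).primesOver (𝓞 K)).ncard = 2 →
            ∀ (f : CuspForm (CongruenceSubgroup.Gamma0 N) 2), IsNewformOf W f →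
              ∀ (ι' : PadicAlgCl p ≃+* ℂ),
                (∀ (w : InfinitePlace K) (k : 𝓞 K),
                  k ∈ 𝔭.asIdeal ↔ ‖ι'.symm (w.embedding (k : K))‖ < 1) →
                ∀ (ΩK : ℂ) (Ωp : ℂ_[p]) (Q : PowerSeries 𝓞_ℂ_[p]), ΩK ≠ 0 → ‖Ωp‖ = 1 →
                  R1.IsBDPLFunctionInt p ι' 𝔭 κ γ f ΩK Ωp Q →
                    muInvariant p (XAc (W.baseChange K) p κ 𝔭bar ∅ γ) = 0 ∧
                    ∃ m : ℕ, ‖((PowerSeries.coeff m Q : 𝓞_ℂ_[p]) : ℂ_[p])‖ = 1 ∧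
                      ∀ i < m, ‖((PowerSeries.coeff i Q : 𝓞_ℂ_[p]) : ℂ_[p])‖ < 1) :
    (∀ (W : WeierstrassCurve ℚ) [W.IsElliptic] [W.IsGloballyMinimal] (p : ℕ) [Fact p.Prime],
      CellC W p → ¬ W.HasSplitMultiplicativeReductionAtPrime p → NonsplitIMCEqOnTreeIntOther W p) ∧
    (∀ (W : WeierstrassCurve ℚ) [W.IsElliptic] [W.IsGloballyMinimal] (p : ℕ) [Fact p.Prime],
      CellC W p → W.HasSplitMultiplicativeReductionAtPrime p → SplitIMCEqOnTreeIntOther W p) :=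
  ⟨fun W _ _ p _ hc hns ↦ nonsplitIMCEqOnTreeIntOther_of_div_of_revDiv_of_mu hGZK hnf hPT hPT2
      (hdivN W p hc hns) (hrev W p hc) (hmuN W p),
    fun W _ _ p _ hc hs ↦ splitIMCEqOnTreeIntOther_of_div_of_revDiv_of_mu hGZK hnf hPT hPT2
      (hdivS W p hc hs) (hrev W p hc) (hmuS W p)⟩

/-- **Crux 4 `BSDpOnCellC` BY NAME from [17 PUB facts] + [road R-β, each sign] + [road H] + [`μ = 0` on
both sides at every datum] + [crux 3]** — `hPub` = the registered `stub_publishedFacts` signature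
VERBATIM, `hMCB` = crux 3 verbatim; composition = the skeleton's own p488773 +
`Reoriented.stub_c2_of_thm151_thm153`, `stub_c3` supplied by `stub_c3_of_pub_of_div_of_revDiv_of_mu`.
CONDITIONAL-RESULT: the alternative published-tier price of the crux on line b1 (road H in place of the
`λ`-lower-bound of p613384); BSD is proved for no curve. [claim: KellerYin2024, status: under-review]
[cite: KellerYin2024, §3, §5.1 (a)–(e) and Thm. 5.1.3 = Thm. D (arXiv:2402.12781v2) (shape only; nothing asserted)]
[cite: Castella2018Exceptional, Thm. 2.10 and Thm. 2.11] [cite: LiuZhangZhang2018, Thm. 1.5.1 and Thm. 1.5.3]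
[cite: Hsieh2014, Thm. 1] [cite: Miller2011LMS, Def. 1.1] -/
theorem bsdpOnCellC_of_publishedFacts_of_div_of_revDiv_of_mu_of_cellB
    (hPub : ((lambdaMu_multiplicative_of_gvPar ∧ thm16_charIdeal_dvd_multiplicative_of_reducible ∧
      thm61_splitMultiplicative ∧ thm61_nonsplitMultiplicative ∧
      (∀ (W : WeierstrassCurve ℚ) [W.IsElliptic] [W.IsGloballyMinimal] (p : ℕ) [Fact p.Prime],
        greenberg_stevens (W := W) (p := p)) ∧
      exists_isNewformOf ∧
      (∀ (K : Type) [Field K] [NumberField K], poitouTate_selmerStructure_duality K) ∧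
      (∀ (K : Type) [Field K] [NumberField K], poitouTate_sha_tateDual K) ∧
      hsieh2014_exists_anticyclotomicPAdicLFunction ∧
      (∀ (N : ℕ) [NeZero N] (W : WeierstrassCurve ℚ) (K : Type) [Field K] [NumberField K],
        gross_zagier N W K) ∧
      (∀ (N : ℕ) [NeZero N] (W : WeierstrassCurve ℚ) (K : Type) [Field K] [NumberField K],
        kolyvagin N W K) ∧
      rank_eq_analyticRank_of_analyticRank_le_one ∧ HoffsteinLuo1997_exists_twist_L_one_ne_zero ∧
      mazur_not_dvd_maninConstant_of_odd ∧ bsdRHS_eq_of_isIsogenous) ∧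
      thm210_thm211_bdpDisplay_pNew) ∧
      LiuZhangZhang2018.thm151_thm153_modularCurve_heegnerVector)
    (hdivN : ∀ (W : WeierstrassCurve ℚ) [W.IsElliptic] [W.IsGloballyMinimal] (p : ℕ) [Fact p.Prime],
      CellC W p → ¬ W.HasSplitMultiplicativeReductionAtPrime p → NonsplitKolyvaginDivOnTreeIntOther W p)
    (hdivS : ∀ (W : WeierstrassCurve ℚ) [W.IsElliptic] [W.IsGloballyMinimal] (p : ℕ) [Fact p.Prime],
      CellC W p → W.HasSplitMultiplicativeReductionAtPrime p → SplitKolyvaginDivOnTreeIntOther W p)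
    (hrev : ∀ (W : WeierstrassCurve ℚ) [W.IsElliptic] [W.IsGloballyMinimal] (p : ℕ) [Fact p.Prime],
      CellC W p → HidaLimitRevDivOnTreeIntOther W p)
    (hmuN : ∀ (W : WeierstrassCurve ℚ) [W.IsElliptic] [W.IsGloballyMinimal] (p : ℕ) [Fact p.Prime],
      ∀ (N : ℕ) [NeZero N] (K : Type) [Field K] [NumberField K] (Dt : ModularParametrizationData W N)
        (H : HeegnerDatum N (NumberField.discr K)) (ιK : K →+* ℂ) (P : (W.baseChange K).toAffine.Point),
        CellC W p → ¬ W.HasSplitMultiplicativeReductionAtPrime p → W.conductorNorm ℤ = N →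
        IsImaginaryQuadratic K → NumberField.discr K < -4 → SatisfiesHeegnerHypothesis N K →
        (W.quadraticTwist (NumberField.discr K : ℚ)).entireLFunction 1 ≠ 0 →
        WeierstrassCurve.Affine.Point.map ιK.toRatAlgHom P = heegnerPointComplex Dt H →
        ¬ (p : ℤ) ∣ Dt.c → ¬ IsOfFinAddOrder P →
        Odd (NumberField.discr K) →
        ∀ (κ : ZpExtension K p), κ.IsAnticyclotomic →
          ∀ (γ : Field.absoluteGaloisGroup K) [Fact (κ.IsTopGenerator γ)]
            (𝔭 : HeightOneSpectrum (𝓞 K)), ((p : ℕ) : 𝓞 K) ∈ 𝔭.asIdeal →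
            𝔭.asIdeal.ramificationIdx (𝓞 ℚ) = 1 → 𝔭.asIdeal.inertiaDeg (𝓞 ℚ) = 1 →
            ∀ (𝔭bar : HeightOneSpectrum (𝓞 K)), ((p : ℕ) : 𝓞 K) ∈ 𝔭bar.asIdeal → 𝔭bar ≠ 𝔭 →
              ((Ideal.span {(p : ℤ)}).primesOver (𝓞 K)).ncard = 2 →
            ∀ (f : CuspForm (CongruenceSubgroup.Gamma0 N) 2), IsNewformOf W f →
              ∀ (ι' : PadicAlgCl p ≃+* ℂ),
                (∀ (w : InfinitePlace K) (k : 𝓞 K),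
                  k ∈ 𝔭.asIdeal ↔ ‖ι'.symm (w.embedding (k : K))‖ < 1) →
                ∀ (ΩK : ℂ) (Ωp : ℂ_[p]) (Q : PowerSeries 𝓞_ℂ_[p]), ΩK ≠ 0 → ‖Ωp‖ = 1 →
                  R1.IsBDPLFunctionInt p ι' 𝔭 κ γ f ΩK Ωp Q →
                    muInvariant p (XAc (W.baseChange K) p κ 𝔭bar ∅ γ) = 0 ∧
                    ∃ m : ℕ, ‖((PowerSeries.coeff m Q : 𝓞_ℂ_[p]) : ℂ_[p])‖ = 1 ∧
                      ∀ i < m, ‖((PowerSeries.coeff i Q : 𝓞_ℂ_[p]) : ℂ_[p])‖ < 1)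
    (hmuS : ∀ (W : WeierstrassCurve ℚ) [W.IsElliptic] [W.IsGloballyMinimal] (p : ℕ) [Fact p.Prime],
      ∀ (N : ℕ) [NeZero N] (K : Type) [Field K] [NumberField K] (Dt : ModularParametrizationData W N)
        (H : HeegnerDatum N (NumberField.discr K)) (ιK : K →+* ℂ) (P : (W.baseChange K).toAffine.Point),
        CellC W p → W.HasSplitMultiplicativeReductionAtPrime p → W.conductorNorm ℤ = N →
        IsImaginaryQuadratic K → NumberField.discr K < -4 → SatisfiesHeegnerHypothesis N K →
        (W.quadraticTwist (NumberField.discr K : ℚ)).entireLFunction 1 ≠ 0 →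
        WeierstrassCurve.Affine.Point.map ιK.toRatAlgHom P = heegnerPointComplex Dt H →
        ¬ (p : ℤ) ∣ Dt.c → ¬ IsOfFinAddOrder P →
        Odd (NumberField.discr K) →
        ∀ (κ : ZpExtension K p), κ.IsAnticyclotomic →
          ∀ (γ : Field.absoluteGaloisGroup K) [Fact (κ.IsTopGenerator γ)]
            (𝔭 : HeightOneSpectrum (𝓞 K)), ((p : ℕ) : 𝓞 K) ∈ 𝔭.asIdeal →
            𝔭.asIdeal.ramificationIdx (𝓞 ℚ) = 1 → 𝔭.asIdeal.inertiaDeg (𝓞 ℚ) = 1 →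
            ∀ (𝔭bar : HeightOneSpectrum (𝓞 K)), ((p : ℕ) : 𝓞 K) ∈ 𝔭bar.asIdeal → 𝔭bar ≠ 𝔭 →
              ((Ideal.span {(p : ℤ)}).primesOver (𝓞 K)).ncard = 2 →
            ∀ (f : CuspForm (CongruenceSubgroup.Gamma0 N) 2), IsNewformOf W f →
              ∀ (ι' : PadicAlgCl p ≃+* ℂ),
                (∀ (w : InfinitePlace K) (k : 𝓞 K),
                  k ∈ 𝔭.asIdeal ↔ ‖ι'.symm (w.embedding (k : K))‖ < 1) →
                ∀ (ΩK : ℂ) (Ωp : ℂ_[p]) (Q : PowerSeries 𝓞_ℂ_[p]), ΩK ≠ 0 → ‖Ωp‖ = 1 →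
                  R1.IsBDPLFunctionInt p ι' 𝔭 κ γ f ΩK Ωp Q →
                    muInvariant p (XAc (W.baseChange K) p κ 𝔭bar ∅ γ) = 0 ∧
                    ∃ m : ℕ, ‖((PowerSeries.coeff m Q : 𝓞_ℂ_[p]) : ℂ_[p])‖ = 1 ∧
                      ∀ i < m, ‖((PowerSeries.coeff i Q : 𝓞_ℂ_[p]) : ℂ_[p])‖ < 1)
    (hMCB : Summit.BirchSwinnertonDyer.BirchSwinnertonDyer.Theses.EisensteinPrimes.MazurMCOnCellB) :
    Summit.BirchSwinnertonDyer.BirchSwinnertonDyer.Theses.EisensteinPrimes.BSDpOnCellC := by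
  obtain ⟨-, -, -, -, -, hnf, hPT, hPT2, -, -, -, hGZK, -, -, -⟩ := hPub.1.1
  exact Reoriented.bsdpOnCellC_of_stubs_reoriented hPub.1 (Reoriented.stub_c2_of_thm151_thm153 hPub.2)
    (stub_c3_of_pub_of_div_of_revDiv_of_mu hGZK hnf hPT hPT2 hdivN hdivS hrev hmuN hmuS) hMCB

end Summit.BirchSwinnertonDyer.BirchSwinnertonDyer.Theorems.StubC3TwoDivisibilities

end
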